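import Summits.NavierStokesRegularity.NavierStokesRegularity.Theses.RellichScar
import Summits.NavierStokesRegularity.NavierStokesRegularity.Theorems.ScarRigidity.Negative.LogicAndLoadBearing
import Literature.Analysis.FluidPDE.TypeIAncientMild
import Literature.Analysis.FluidPDE.ParasiticSlabFlow
import Summits.NavierStokesRegularity.NavierStokesRegularity.Theorems.RellichScarScarRigidityCoulombSlice
import Summits.NavierStokesRegularity.NavierStokesRegularity.Theorems.RellichScarScarRigidityCoulombDerivative
import Summits.NavierStokesRegularity.NavierStokesRegularity.Theorems.RellichScarScarRigidityCoulombVanishing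
import Summits.NavierStokesRegularity.NavierStokesRegularity.Theorems.RellichScarScarRigidityLogConvexityL2Energy
import Summits.NavierStokesRegularity.NavierStokesRegularity.Theorems.RellichScarScarRigidityLogConvexityDifference
import HarnessLib

/-!
# `ScarRigidity` — line `finite-energy-log-convexity`, stub `stub_coulombEnergyPackage`:
# the Coulomb (`Ḣ⁻¹`) energy package of the difference of two apex profiles (crux stmt-NavierStokesRegularity-11717)

The registered stub `stub_coulombEnergyPackage` of the lead's skeleton (S4-E, the one analytic input of
`stub_logConvexityBelowThreshold`), ASSEMBLED from the helper files of the package: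

* `N(t) = -∫ ⟪w(t), Γ ⋆ w(t)⟫` (`w = V₁ - V₂`, `Γ = newtonKernel = -1/(4π|z|)`; `N = ‖∇(Γ ⋆ w)‖²₂ ≥ 0` is the
  Coulomb energy `‖w(t)‖²_{Ḣ⁻¹}`), `b(t) = ∫ ‖w(t)‖²`;
* `N' = -2 ∫ ⟪∂ₜw, Γ ⋆ w⟫` (`…CoulombDerivative`: dominated differentiation of the double integral,
  Fubini, symmetry of the kernel), `b' = ∫ 2⟪w, ∂ₜw⟫` (`…LogConvexityL2Energy`);
* at each `t < 0` the difference equation `∂ₜw = Δw - ∇(Q₁ - Q₂) - ((w·∇)V₁ + (V₂·∇)w)`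
  (`…LogConvexityDifference`) and the slice package (`…CoulombSlice`: the Newtonian potential of the
  slice is `C²`, divergence free, solves `Δψ = w` and decays; Green identities; pairing bounds;
  `frequencyLaw_of_pairings`) give `N' = -2b + 2p`, `b' = -2c + 2q`, the energy inequality
  `N' ≥ -(2b + (4C/√(-t))√(bN))`, the frequency law `b'N - bN' ≤ (2C²/(-t)) bN`, and `N = 0 ⇒ w = 0`;
* `N(t) → 0` as `t ↑ 0` (`…CoulombVanishing`: `|N(t)| ≤ C₀ K'² (-t)^{3/2}`).
-/

noncomputable section

open Set Filter Function MeasureTheory Metric TopologicalSpace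
open scoped Topology ENNReal NNReal RealInnerProductSpace
open Literature.Analysis.FluidPDE
open Summit.NavierStokesRegularity.NavierStokesRegularity.Theses.RellichScar
open Summit.NavierStokesRegularity.NavierStokesRegularity.Theorems.ScarRigidity.Negative

set_option linter.dupNamespace false

namespace Summit.NavierStokesRegularity.NavierStokesRegularity.Theorems.RellichScarScarRigidity

open Real
open scoped Laplacian

/-! ## The energy package -/

/-- **S4-E `stub_coulombEnergyPackage` — the Coulomb (`Ḣ⁻¹`) energy package of the twin difference.** For
two classical apex profiles with the S1β bounds and the S2 package, the difference `w = V₁ - V₂` carries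
real functions `N, b ≥ 0` (the Coulomb energy `‖w(t)‖²_{Ḣ⁻¹} = -∫⟪w, Γ ⋆ w⟫` and `‖w(t)‖²_{L²}`),
differentiable on `t < 0`, with the Agmon–Nirenberg energy inequality and frequency law at constant `C`,
`N(t) → 0` as `t ↑ 0`, and `N(t) = 0 ⇒ w(t) = 0` (module docstring). [folklore] -/
theorem stub_coulombEnergyPackage :
    ∀ (V₁ V₂ : ℝ → EuclideanSpace ℝ (Fin 3) → EuclideanSpace ℝ (Fin 3))
      (Q₁ Q₂ : ℝ → EuclideanSpace ℝ (Fin 3) → ℝ) (a₁ a₂ : ℝ → ℝ) (C L₁ L₂ K' : ℝ), 0 < C →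
      IsClassicalNSSolutionOn (Iio (0 : ℝ)) 1 0 V₁ Q₁ → IsClassicalNSSolutionOn (Iio (0 : ℝ)) 1 0 V₂ Q₂ →
      HasTypeIDecay C V₁ → HasTypeIDecay C V₂ →
      (∀ t < 0, ∀ x : EuclideanSpace ℝ (Fin 3), ‖fderiv ℝ (V₁ t) x‖ ≤ L₁ / (‖x‖ + Real.sqrt (-t)) ^ 2) →
      (∀ t < 0, ∀ x : EuclideanSpace ℝ (Fin 3),
        ‖iteratedFDeriv ℝ 2 (V₁ t) x‖ ≤ L₁ / (‖x‖ + Real.sqrt (-t)) ^ 3) →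
      (∀ t < 0, ∀ x : EuclideanSpace ℝ (Fin 3),
        ‖deriv (fun s => V₁ s x) t‖ ≤ L₁ / (‖x‖ + Real.sqrt (-t)) ^ 3) →
      (∀ t < 0, ∀ x : EuclideanSpace ℝ (Fin 3), |Q₁ t x - a₁ t| ≤ L₁ / (‖x‖ + Real.sqrt (-t)) ^ 2) →
      (∀ t < 0, ∀ x : EuclideanSpace ℝ (Fin 3), ‖gradient (Q₁ t) x‖ ≤ L₁ / (‖x‖ + Real.sqrt (-t)) ^ 3) →
      (∀ t < 0, ∀ x : EuclideanSpace ℝ (Fin 3), ‖fderiv ℝ (V₂ t) x‖ ≤ L₂ / (‖x‖ + Real.sqrt (-t)) ^ 2) →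
      (∀ t < 0, ∀ x : EuclideanSpace ℝ (Fin 3),
        ‖iteratedFDeriv ℝ 2 (V₂ t) x‖ ≤ L₂ / (‖x‖ + Real.sqrt (-t)) ^ 3) →
      (∀ t < 0, ∀ x : EuclideanSpace ℝ (Fin 3),
        ‖deriv (fun s => V₂ s x) t‖ ≤ L₂ / (‖x‖ + Real.sqrt (-t)) ^ 3) →
      (∀ t < 0, ∀ x : EuclideanSpace ℝ (Fin 3), |Q₂ t x - a₂ t| ≤ L₂ / (‖x‖ + Real.sqrt (-t)) ^ 2) →
      (∀ t < 0, ∀ x : EuclideanSpace ℝ (Fin 3), ‖gradient (Q₂ t) x‖ ≤ L₂ / (‖x‖ + Real.sqrt (-t)) ^ 3) →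
      (∀ t < 0,
        (∀ x : EuclideanSpace ℝ (Fin 3), ‖V₁ t x - V₂ t x‖ ≤ K' * (-t) / (‖x‖ + Real.sqrt (-t)) ^ 3) ∧
        eLpNorm (fun x => V₁ t x - V₂ t x) 2 volume ≤ ENNReal.ofReal (K' * (-t) ^ ((1 : ℝ) / 4)) ∧
        eLpNorm (fun x => V₁ t x - V₂ t x) ((6 : ℝ≥0∞) / 5) volume ≤
          ENNReal.ofReal (K' * (-t) ^ ((3 : ℝ) / 4)) ∧
        eLpNorm (fun x => fderiv ℝ (V₁ t) x - fderiv ℝ (V₂ t) x) 2 volume ≤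
          ENNReal.ofReal (K' * (-t) ^ (-(1 : ℝ) / 4))) →
      ∃ N b N' b' : ℝ → ℝ,
        (∀ t < 0, HasDerivAt N (N' t) t) ∧ (∀ t < 0, HasDerivAt b (b' t) t) ∧
        (∀ t < 0, 0 ≤ N t) ∧ (∀ t < 0, 0 ≤ b t) ∧
        (∀ t < 0, -(2 * b t + 4 * C / Real.sqrt (-t) * Real.sqrt (b t * N t)) ≤ N' t) ∧
        (∀ t < 0, b' t * N t - b t * N' t ≤ 2 * C ^ 2 / (-t) * (b t * N t)) ∧
        Tendsto N (𝓝[<] 0) (𝓝 0) ∧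
        (∀ t < 0, N t = 0 → ∀ x : EuclideanSpace ℝ (Fin 3), V₁ t x = V₂ t x) := by
  intro V₁ V₂ Q₁ Q₂ a₁ a₂ C L₁ L₂ K' hC hcl₁ hcl₂ hd₁ hd₂ hg₁ hh₁ ht₁ hq₁ hgq₁ hg₂ hh₂ ht₂ hq₂ hgq₂ hK'
  -- joint smoothness and the majorants of `w` and `∂ₜw`
  have hsm₁ : IsSmoothSpaceTimeOn (Iio (0 : ℝ)) V₁ := hcl₁.smooth_velocity
  have hsm₂ : IsSmoothSpaceTimeOn (Iio (0 : ℝ)) V₂ := hcl₂.smooth_velocity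
  have hwsm : IsSmoothSpaceTimeOn (Iio (0 : ℝ)) (fun s x => V₁ s x - V₂ s x) := hsm₁.sub hsm₂
  have hwb : ∀ s < 0, ∀ y : EuclideanSpace ℝ (Fin 3),
      ‖V₁ s y - V₂ s y‖ ≤ K' * (-s) / (‖y‖ + Real.sqrt (-s)) ^ 3 := fun s hs y => (hK' s hs).1 y
  have hdw : ∀ s < 0, ∀ x : EuclideanSpace ℝ (Fin 3), deriv (fun τ => V₁ τ x - V₂ τ x) s =
      deriv (fun τ => V₁ τ x) s - deriv (fun τ => V₂ τ x) s := fun s hs x =>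
    ((hsm₁.hasDerivAt_timeLine isOpen_Iio hs x).sub (hsm₂.hasDerivAt_timeLine isOpen_Iio hs x)).deriv
  have hdb : ∀ s < 0, ∀ y : EuclideanSpace ℝ (Fin 3),
      ‖deriv (fun τ => V₁ τ y - V₂ τ y) s‖ ≤ (|L₁| + |L₂|) / (‖y‖ + Real.sqrt (-s)) ^ 3 := by
    intro s hs y
    have hρ : 0 ≤ (‖y‖ + Real.sqrt (-s)) ^ 3 := by positivity
    rw [hdw s hs y, add_div]
    exact (norm_sub_le _ _).trans (add_le_add
      ((ht₁ s hs y).trans (div_le_div_of_nonneg_right (le_abs_self _) hρ))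
      ((ht₂ s hs y).trans (div_le_div_of_nonneg_right (le_abs_self _) hρ)))
  -- the difference equation
  have hF : ∀ t < 0, ∀ x : EuclideanSpace ℝ (Fin 3), deriv (fun τ => V₁ τ x - V₂ τ x) t =
      ((Δ (V₁ t)) x - (Δ (V₂ t)) x) - (gradient (Q₁ t) x - gradient (Q₂ t) x) -
        (convect (fun y => V₁ t y - V₂ t y) (V₁ t) x + convect (V₂ t) (fun y => V₁ t y - V₂ t y) x) :=
    fun t ht x => by rw [hdw t ht x, deriv_sub_eq_of_classical hcl₁ hcl₂ ht x]
  refine ⟨fun t => -∫ x, ⟪V₁ t x - V₂ t x, ∫ y, newtonKernel (x - y) • (V₁ t y - V₂ t y)⟫,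
    fun t => ∫ x, ‖V₁ t x - V₂ t x‖ ^ 2,
    fun t => -(2 * ∫ x, ⟪deriv (fun τ => V₁ τ x - V₂ τ x) t, ∫ y, newtonKernel (x - y) • (V₁ t y - V₂ t y)⟫),
    fun t => ∫ x, 2 * ⟪V₁ t x - V₂ t x, deriv (fun s => V₁ s x) t - deriv (fun s => V₂ s x) t⟫,
    fun t ht => (hasDerivAt_integral_inner_newtonPotential hwsm hwb hdb ht).neg,
    fun t ht => (hasDerivAt_integral_norm_sq_sub hsm₁ hsm₂ hd₁ hd₂ ht₁ ht₂ (fun t ht x => (hK' t ht).1 x) ht).2,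
    ?_, fun t _ => integral_nonneg fun x => sq_nonneg _, ?_, ?_, ?_, ?_⟩
  -- the slice package at a fixed `t < 0`
  · intro t ht
    obtain ⟨N₀, b₀, c₀, p₀, q₀, hN₀, -, hN₀0, -⟩ := coulomb_slice (c₁ := a₁ t) (c₂ := a₂ t)
      (contDiff_infty.1 (hcl₁.contDiff_velocity ht) 2) (contDiff_infty.1 (hcl₂.contDiff_velocity ht) 2)
      (contDiff_infty.1 (hcl₁.contDiff_pressure ht) 1) (contDiff_infty.1 (hcl₂.contDiff_pressure ht) 1)
      (hcl₁.divFree t ht) (hcl₂.divFree t ht) hC.le (Real.sqrt_pos.2 (by linarith)) (hd₁ t ht) (hd₂ t ht)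
      (hg₁ t ht) (hh₁ t ht) (hq₁ t ht) (hgq₁ t ht) (hg₂ t ht) (hh₂ t ht) (hq₂ t ht) (hgq₂ t ht) (hwb t ht)
    beta_reduce; rw [← hN₀]; exact hN₀0
  · intro t ht
    obtain ⟨N₀, b₀, c₀, p₀, q₀, hN₀, hb₀, -, hS2, -, h5, -, -⟩ := coulomb_slice (c₁ := a₁ t) (c₂ := a₂ t)
      (contDiff_infty.1 (hcl₁.contDiff_velocity ht) 2) (contDiff_infty.1 (hcl₂.contDiff_velocity ht) 2)
      (contDiff_infty.1 (hcl₁.contDiff_pressure ht) 1) (contDiff_infty.1 (hcl₂.contDiff_pressure ht) 1)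
      (hcl₁.divFree t ht) (hcl₂.divFree t ht) hC.le (Real.sqrt_pos.2 (by linarith)) (hd₁ t ht) (hd₂ t ht)
      (hg₁ t ht) (hh₁ t ht) (hq₁ t ht) (hgq₁ t ht) (hg₂ t ht) (hh₂ t ht) (hq₂ t ht) (hgq₂ t ht) (hwb t ht)
    have eN' : -(2 * ∫ x, ⟪deriv (fun τ => V₁ τ x - V₂ τ x) t,
        ∫ y, newtonKernel (x - y) • (V₁ t y - V₂ t y)⟫) = -2 * b₀ + 2 * p₀ := by
      rw [integral_congr_ae (Eventually.of_forall fun x => by beta_reduce; rw [hF t ht x]), hS2]; ring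
    rw [← eN', hb₀, hN₀] at h5
    beta_reduce; exact h5
  · intro t ht
    obtain ⟨N₀, b₀, c₀, p₀, q₀, hN₀, hb₀, -, hS2, hS3, -, h6, -⟩ := coulomb_slice (c₁ := a₁ t) (c₂ := a₂ t)
      (contDiff_infty.1 (hcl₁.contDiff_velocity ht) 2) (contDiff_infty.1 (hcl₂.contDiff_velocity ht) 2)
      (contDiff_infty.1 (hcl₁.contDiff_pressure ht) 1) (contDiff_infty.1 (hcl₂.contDiff_pressure ht) 1)
      (hcl₁.divFree t ht) (hcl₂.divFree t ht) hC.le (Real.sqrt_pos.2 (by linarith)) (hd₁ t ht) (hd₂ t ht)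
      (hg₁ t ht) (hh₁ t ht) (hq₁ t ht) (hgq₁ t ht) (hg₂ t ht) (hh₂ t ht) (hq₂ t ht) (hgq₂ t ht) (hwb t ht)
    have eN' : -(2 * ∫ x, ⟪deriv (fun τ => V₁ τ x - V₂ τ x) t,
        ∫ y, newtonKernel (x - y) • (V₁ t y - V₂ t y)⟫) = -2 * b₀ + 2 * p₀ := by
      rw [integral_congr_ae (Eventually.of_forall fun x => by beta_reduce; rw [hF t ht x]), hS2]; ring
    have eb' : ∫ x, 2 * ⟪V₁ t x - V₂ t x, deriv (fun s => V₁ s x) t - deriv (fun s => V₂ s x) t⟫ =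
        -2 * c₀ + 2 * q₀ := by
      rw [← hS3]
      exact integral_congr_ae (Eventually.of_forall fun x => by
        beta_reduce; rw [deriv_sub_eq_of_classical hcl₁ hcl₂ ht x])
    rw [← eN', ← eb', hb₀, hN₀, Real.sq_sqrt (by linarith : (0 : ℝ) ≤ -t)] at h6
    beta_reduce; exact h6
  -- vanishing at the final time
  · simpa using (tendsto_integral_inner_newtonPotential hwb).neg
  -- `N = 0 ⇒ w = 0`
  · intro t ht hN x
    obtain ⟨N₀, b₀, c₀, p₀, q₀, hN₀, -, -, -, -, -, -, hker⟩ := coulomb_slice (c₁ := a₁ t) (c₂ := a₂ t)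
      (contDiff_infty.1 (hcl₁.contDiff_velocity ht) 2) (contDiff_infty.1 (hcl₂.contDiff_velocity ht) 2)
      (contDiff_infty.1 (hcl₁.contDiff_pressure ht) 1) (contDiff_infty.1 (hcl₂.contDiff_pressure ht) 1)
      (hcl₁.divFree t ht) (hcl₂.divFree t ht) hC.le (Real.sqrt_pos.2 (by linarith)) (hd₁ t ht) (hd₂ t ht)
      (hg₁ t ht) (hh₁ t ht) (hq₁ t ht) (hgq₁ t ht) (hg₂ t ht) (hh₂ t ht) (hq₂ t ht) (hgq₂ t ht) (hwb t ht)
    exact hker (hN₀.trans hN) x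

end Summit.NavierStokesRegularity.NavierStokesRegularity.Theorems.RellichScarScarRigidity

end
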